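import Literature.Geometry.Riemannian.ShrinkerEntropyProofs
import Literature.Geometry.Riemannian.ShrinkerScalarCurvatureNonnegHolds
import Literature.Geometry.Riemannian.ShrinkerPotentialGrowthProofs
import Literature.Geometry.Lorentzian.HessianLinear
import Literature.Geometry.Lorentzian.BlackHoles
import Summits.SmoothPoincare4.SmoothPoincare4.Theorems.EntropyRungNoncompactShrinkerGapStubCompactSupportLSIMixture
import HarnessLib

/-!
# Helper `helper_bakryEmeryLSI_of_logSobolev` of line `collapsed-ends-usc` (crux
# `EntropyRung.NoncompactShrinkerGap`, stmt-SmoothPoincare4-10868): the registered fact stub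
# `stub_bakryEmeryLSI` (BE) IS the textbook Bakry–Émery logarithmic Sobolev inequality of a complete
# `CD(K, ∞)` weighted manifold, specialised to the shrinker measure

Skeleton v8/v9 of the line (`Cruxes/NoncompactShrinkerGap/Lines/collapsed_ends_usc.lean`) shrank the
Carrillo–Ni debt to ONE registered fact stub, `stub_bakryEmeryLSI` (def `BakryEmeryLSI`): on a complete
connected normalised gradient shrinker `(M, g, f)` (`Ric + Hess f = g/2`, `R + |∇f|² = f`), for every
smooth compatible `ψ` (`u = (4π)^{-n/2} e^{-ψ}` of unit mass) of bounded second moment and finite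
Fisher information, `∫ (f + log Θ − ψ) u ≤ ∫ |∇(f − ψ)|² u`, `Θ = (4π)^{-n/2} ∫ e^{-f}` — verbatim the
hypothesis `hlsi` of `CarrilloNi2009_shrinkerLSI.clause_ii_of_lsi`. This file proves that BE is an
INSTANCE of the general published theorem — the Bakry–Émery logarithmic Sobolev inequality of a complete
`CD(K, ∞)` weighted manifold, written out here as the HYPOTHESIS `hBE` in the shape of the tree's closed-manifold
theorem `logSobolev_of_heatExistence` (`WeightedHeatFlowAPriori.lean`) and filed separately as the Literature named
fact `bakryEmery_logSobolev_complete` (proposal p116121, `Literature/Geometry/Riemannian/BakryEmeryLogSobolev.lean`):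

* J. A. Carrillo, L. Ni, arXiv:0806.2417 = Comm. Anal. Geom. 17 (2009), **Thm. 3.1** (p. 7, "[V08]
  and [BE]"): "Let `M` be a Riemannian manifold [p. 7: "a smooth, complete connected
  finite-dimensional Riemannian manifold distinct from a point"] equipped with a reference measure
  `e^{-V} dΓ` [normalised by `∫_M e^{-V} dΓ = 1`] where the potential `V ∈ C²(M)` verifies a
  curvature-dimension bound of the type `C(K, ∞)` with `K ∈ ℝ` [`R_{ij} + V_{ij} ≥ K g_{ij}`]. Then, for
  any given `ν ∈ P₂` absolutely continuous with respect to volume measure `dΓ` with density `ρ`, it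
  holds the HWI inequality … As a consequence, we have that whenever `K > 0`, the following LSI follows
  `H_V(ρ) ≤ (1/2K) I_V(ρ)`", with `H_V(ρ) = ∫ ρ ξ dΓ`, `I_V(ρ) = ∫ |∇ξ|² ρ dΓ`, `ξ = log ρ + V` (p. 7).
* D. Bakry, I. Gentil, M. Ledoux, *Analysis and Geometry of Markov Diffusion Operators* (Springer
  2014), **Prop. 5.7.1** (p. 268): "Under the curvature condition `CD(ρ, ∞)`, `ρ > 0`, the Markov
  Triple `(E, μ, Γ)` satisfies a logarithmic Sobolev inequality `LS(C)` with constant `C = 1/ρ`. That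
  is, for every function `f ∈ 𝒟(ℰ)`, `Ent_μ(f²) ≤ (2/ρ) ℰ(f)`", and (after Cor. 5.7.2, p. 268) "a similar
  statement, with the same proof, holds on a weighted Riemannian manifold `(M, 𝔤)` for the operator
  `L = Δ_𝔤 − ∇W · ∇` with the reversible (probability) measure `μ` having density `e^{-W}` with respect to
  the Riemannian measure under the curvature condition `Ric(L) = Ric_𝔤 + ∇∇W ≥ ρ 𝔤`" (complete
  manifolds, §3.2 and §C.6). Original: D. Bakry, M. Émery, *Diffusions hypercontractives*, Sém. Probab.
  XIX, LNM 1123 (1985), 177–206.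

Rendering of the hypothesis (= the fact `bakryEmery_logSobolev_complete`): `M` connected, modelled on `ℝⁿ`, `g` a
complete Riemannian metric (closed `g.riemEDist`-balls compact) with its Levi-Civita connection,
`V` smooth with `K g ≤ Ric + Hess V`, `K > 0`, `∫ e^{-V} dV_g = 1`; densities `ρ = e^{φ − V}` with `φ`
smooth, `∫ e^{φ} e^{-V} = 1` (so `ν = ρ dΓ ∈ P`), bounded second moment (`∈ P₂`) and integrable Fisher
integrand `|∇φ|² e^{φ} e^{-V}` (so that the tree's Bochner `I_V` IS the printed one); conclusion
`∫ φ e^{φ} e^{-V} ≤ (2K)⁻¹ ∫ |∇φ|² e^{φ} e^{-V}` (`ξ = φ`; if the entropy integrand is not integrable the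
left side is Mathlib's junk `0 ≤` right side, consistent). This is the closed-manifold theorem
`logSobolev_of_heatExistence` with `[CompactSpace M]` replaced by completeness + `P₂` + finite Fisher
information, i.e. exactly the printed complete case.

The specialisation (`relEntropy_le_relFisher_of_logSobolev`, registered as
`helper_bakryEmeryLSI_of_logSobolev`): `V = f + log ∫e^{-f}` (a probability density by Carrillo–Ni (i),
a theorem since `R ≥ 0` landed: `shrinkerScalarCurvature_nonneg_holds` ⇒ minimum point and lower growth
of `f` ⇒ `f` proper ⇒ `integrable_exp_neg_of_proper`), `K = ½` (`Hess V = Hess f`, `hessian_add`,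
`hessian_const`; the soliton equation), `φ = f + log Θ − ψ` (`e^{φ}e^{-V} = (4π)^{-n/2}e^{-ψ} = u`), the
second moment carried over verbatim, and the Fisher integrand of `φ` integrable because
`|∇(f − ψ)|² ≤ 2|∇f|² + 2|∇ψ|²` (`gradSq_sub`, `abs_innerDual_mvfderiv_le`), `|∇f|² u ≤ f u ∈ L¹`
(`integrable_potential_mul_of_secondMoment`, `R ≥ 0`) and `|∇ψ|² u ∈ L¹` (hypothesis).
-/

noncomputable section

-- `Summit.SmoothPoincare4.SmoothPoincare4.…` (summit = problem) trips `dupNamespace` on every decl.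
set_option linter.dupNamespace false

open scoped Manifold ContDiff ENNReal NNReal Topology
open MeasureTheory Set Filter
open Literature.Geometry.Lorentzian Literature.Geometry.Riemannian

namespace Summit.SmoothPoincare4.SmoothPoincare4.Theorems.NoncompactShrinkerGapBakryEmeryLSI

open Summit.SmoothPoincare4.SmoothPoincare4.Theorems.NoncompactShrinkerGapCompactSupportLSI

/-! ## The shrinker instance -/

section Shrinker

variable {n : ℕ} {M : Type} [TopologicalSpace M] [T2Space M] [SecondCountableTopology M]
  [ChartedSpace (EuclideanSpace ℝ (Fin n)) M] [IsManifold (𝓡 n) ∞ M] [ConnectedSpace M]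
  [T3Space M] [MeasurableSpace M] [BorelSpace M]

/-- **BE from the textbook LSI.** On a complete connected normalised gradient shrinker `(M, g, f)`,
for every smooth compatible `ψ` of bounded second moment and finite Fisher information,
`∫ (f + log Θ − ψ) u ≤ ∫ |∇(f − ψ)|² u` (`u = (4π)^{-n/2}e^{-ψ}`, `Θ = (4π)^{-n/2}∫e^{-f}`) — the
Bakry–Émery inequality of the `CD(½, ∞)` probability space `(M, g, e^{-f}dV/∫e^{-f})` applied to
`ρ = u e^{f}∫e^{-f}`: `V = f + log ∫e^{-f}` is a smooth probability potential (Carrillo–Ni (i) from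
`R ≥ 0` and properness), `Ric + Hess V = Ric + Hess f = g/2`, `φ = log ρ + V = f + log Θ − ψ`,
`|∇φ|² = |∇(f − ψ)|² ≤ 2|∇f|² + 2|∇ψ|²` with `|∇f|² u ≤ f u ∈ L¹`.
[cite: CarrilloNi2009, Thm. 3.1 (p. 7) and §4 (p. 9)] -/
theorem relEntropy_le_relFisher_of_logSobolev
    (hBE : ∀ (n : ℕ) (M : Type) [TopologicalSpace M] [T2Space M] [SecondCountableTopology M] [ChartedSpace (EuclideanSpace ℝ (Fin n)) M] [IsManifold (𝓡 n) ∞ M] [ConnectedSpace M] [T3Space M] [MeasurableSpace M] [BorelSpace M] (g : PseudoRiemannianMetric (𝓡 n) ∞ (EuclideanSpace ℝ (Fin n)) (TangentSpace (𝓡 n) : M → Type _)) [g.HasLeviCivita] (V : M → ℝ) (K : ℝ), g.IsRiemannian → (∀ (x : M) (r : NNReal), IsCompact {y : M | g.riemEDist x y ≤ r}) → ContMDiff (𝓡 n) 𝓘(ℝ, ℝ) ∞ V → 0 < K → (∀ (x : M) (X : TangentSpace (𝓡 n) x), K * g.val x X X ≤ g.ricci x X X + g.hessian V x X X) → ∫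 x, Real.exp (-V x) ∂g.riemVolume = 1 → ∀ φ : M → ℝ, ContMDiff (𝓡 n) 𝓘(ℝ, ℝ) ∞ φ → ∫ x, Real.exp (φ x) * Real.exp (-V x) ∂g.riemVolume = 1 → (∃ o : M, Integrable (fun x ↦ (g.riemEDist o x).toReal ^ 2 * (Real.exp (φ x) * Real.exp (-V x))) g.riemVolume) → Integrable (fun x ↦ g.gradSq φ x * (Real.exp (φ x) * Real.exp (-V x))) g.riemVolume → ∫ x, φ x * (Real.exp (φ x) * Real.exp (-V x)) ∂g.riemVolume ≤ 1 / (2 * K) * ∫ x, g.gradSq φ x * (Real.exp (φ x) * Real.exp (-V x)) ∂g.riemVolume)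
    (g : PseudoRiemannianMetric (𝓡 n) ∞ (EuclideanSpace ℝ (Fin n)) (TangentSpace (𝓡 n) : M → Type _))
    [g.HasLeviCivita] (f : M → ℝ) (hg : g.IsRiemannian)
    (hc : ∀ (x : M) (r : NNReal), IsCompact {y : M | g.edist hg x y ≤ r})
    (hf : ContMDiff (𝓡 n) 𝓘(ℝ, ℝ) ∞ f)
    (hsol : ∀ (x : M) (X Y : TangentSpace (𝓡 n) x),
      g.ricci x X Y + g.hessian f x X Y = (1 / 2 : ℝ) * g.val x X Y)
    (hnorm : ∀ x : M, g.scalarCurvature x + g.gradSq f x = f x)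
    {ψ : M → ℝ} (hψ : ContMDiff (𝓡 n) 𝓘(ℝ, ℝ) ∞ ψ) (hψc : g.IsEntropyCompatible ψ 1)
    (h2 : ∃ o : M, Integrable (fun x ↦ (g.riemEDist o x).toReal ^ 2 * entropyDensity n ψ 1 x)
      g.riemVolume)
    (hgradu : Integrable (fun x ↦ g.gradSq ψ x * entropyDensity n ψ 1 x) g.riemVolume) :
    ∫ x, (f x + Real.log ((4 * Real.pi) ^ (-(n : ℝ) / 2) * ∫ y, Real.exp (-f y) ∂g.riemVolume) - ψ x) *
        entropyDensity n ψ 1 x ∂g.riemVolume ≤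
      ∫ x, g.gradSq (fun y ↦ f y - ψ y) x * entropyDensity n ψ 1 x ∂g.riemVolume := by
  classical
  /- `R ≥ 0`, a minimum point and the lower growth of `f`, properness, Carrillo–Ni (i) -/
  have hS0 : ∀ x, 0 ≤ g.scalarCurvature x :=
    shrinkerScalarCurvature_nonneg_holds n M g f hg hc hf hsol hnorm
  have hk1 : ((1 : ℕ∞) : ℕ∞ω) + 1 ≤ (∞ : ℕ∞ω) := by
    rw [show ((1 : ℕ∞) : ℕ∞ω) + 1 = 2 by norm_num]
    exact WithTop.coe_le_coe.2 le_top
  haveI : CovariantDerivative.ContMDiffCovariantDerivative g.leviCivita 1 :=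
    ⟨g.isLocallyContMDiff_leviCivita_holds 1 hk1 univ isOpen_univ⟩
  haveI : CovariantDerivative.ContMDiffCovariantDerivative g.leviCivita ∞ :=
    ⟨g.isLocallyContMDiff_leviCivita_holds ⊤ (le_of_eq rfl) univ isOpen_univ⟩
  have hgrad : ∀ x, g.gradSq f x ≤ f x := fun x ↦ by linarith [hS0 x, hnorm x]
  obtain ⟨p, hp⟩ := HaslhoferMuller.exists_forall_potential_le g hg hc hf hgrad hsol
  have hlow : ∀ (x : M) (r : NNReal), (r : ℝ≥0∞) ≤ g.edist hg p x →
      (1 / 4 : ℝ) * (max ((r : ℝ) - 5 * n) 0) ^ 2 ≤ f x := fun x r hr ↦ by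
    have h := HaslhoferMuller.potential_lower_of_scalarCurvature_nonneg g hg hc hf hsol hnorm
      hS0 hp x r hr
    rwa [finrank_euclideanSpace_fin] at h
  haveI : Nonempty M := ⟨p⟩
  have hprop : ∀ R : ℝ, IsCompact {x | f x ≤ R} :=
    isCompact_sublevel_of_growth hg hf.continuous hc hlow
  have hint : Integrable (fun x ↦ Real.exp (-f x)) g.riemVolume :=
    (CarrilloNi2009_shrinkerLSI.integrable_exp_neg_of_proper hg hf hsol hnorm hprop).1
  /- the constants `I₀ = ∫e^{-f}`, `A = (4π)^{-n/2}`, `c = log Θ` -/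
  set vol := g.riemVolume with hvol
  set I₀ : ℝ := ∫ y, Real.exp (-f y) ∂vol with hI₀
  set A : ℝ := (4 * Real.pi) ^ (-(n : ℝ) / 2) with hA
  set c : ℝ := Real.log (A * I₀) with hcdef
  have hApos : 0 < A := Real.rpow_pos_of_pos (by positivity) _
  have hΘpos : 0 < A * I₀ := CarrilloNi2009_shrinkerLSI.theta_pos hg hint
  have hI₀pos : 0 < I₀ := pos_of_mul_pos_right hΘpos hApos.le
  have hcA : c = Real.log A + Real.log I₀ := by
    rw [hcdef, Real.log_mul hApos.ne' hI₀pos.ne']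
  /- the density `u` of `ψ`: positive, continuous, unit mass -/
  set u : M → ℝ := entropyDensity n ψ 1 with hu
  have hux : ∀ x, u x = A * Real.exp (-ψ x) := fun x ↦ by
    simp only [hu, entropyDensity_apply, mul_one, hA]
  have hupos : ∀ x, 0 < u x := fun x ↦ entropyDensity_pos n ψ one_pos x
  have hucont : Continuous u := continuous_const.mul (Real.continuous_exp.comp hψ.continuous.neg)
  have hu1 : ∫ x, u x ∂vol = 1 := by
    have := hψc
    rw [PseudoRiemannianMetric.isEntropyCompatible_iff, finrank_euclideanSpace_fin] at this
    exact this
  have huI : Integrable u vol := by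
    by_contra hni
    rw [integral_undef hni] at hu1
    exact zero_ne_one hu1
  /- the probability potential `V = f + log I₀` and the test function `φ = f + c − ψ` -/
  set L : ℝ := Real.log I₀ with hL
  set V : M → ℝ := fun x ↦ f x + L with hV
  set φ : M → ℝ := fun x ↦ (f x - ψ x) + c with hφ
  have hVs : ContMDiff (𝓡 n) 𝓘(ℝ, ℝ) ∞ V := hf.add contMDiff_const
  have hφs : ContMDiff (𝓡 n) 𝓘(ℝ, ℝ) ∞ φ := (hf.sub hψ).add contMDiff_const
  have heV : ∀ x, Real.exp (-V x) = Real.exp (-f x) * I₀⁻¹ := fun x ↦ by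
    simp only [hV]
    rw [neg_add, Real.exp_add, Real.exp_neg L, hL, Real.exp_log hI₀pos]
  have hφV : ∀ x, Real.exp (φ x) * Real.exp (-V x) = u x := fun x ↦ by
    rw [← Real.exp_add, hux]
    have : φ x + -V x = Real.log A + -ψ x := by
      simp only [hφ, hV, hL]
      rw [hcA]
      ring
    rw [this, Real.exp_add, Real.exp_log hApos]
  /- the hypotheses of the general inequality -/
  have hcpl : ∀ (x : M) (r : NNReal), IsCompact {y : M | g.riemEDist x y ≤ r} := fun x r ↦ by
    simpa [PseudoRiemannianMetric.riemEDist_eq hg] using hc x r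
  haveI : Fact ((1 : ℕ∞ω) ≤ (∞ : ℕ∞ω)) := ⟨WithTop.coe_le_coe.2 le_top⟩
  have hHess : ∀ x, g.hessian V x = g.hessian f x := by
    intro x
    have h2f : ContMDiffAt (𝓡 n) 𝓘(ℝ, ℝ) 2 f x :=
      hf.contMDiffAt.of_le (WithTop.coe_le_coe.mpr le_top : (2 : ℕ∞ω) ≤ (∞ : ℕ∞ω))
    have h2c : ContMDiffAt (𝓡 n) 𝓘(ℝ, ℝ) 2 (fun _ : M ↦ L) x := contMDiffAt_const
    have hadd := g.hessian_add h2f h2c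
    rw [g.hessian_const L x, add_zero] at hadd
    exact hadd
  have hRic : ∀ (x : M) (X : TangentSpace (𝓡 n) x),
      (1 / 2 : ℝ) * g.val x X X ≤ g.ricci x X X + g.hessian V x X X := by
    intro x X
    rw [hHess x]
    exact le_of_eq (hsol x X X).symm
  have hmass : ∫ x, Real.exp (-V x) ∂vol = 1 := by
    simp_rw [heV]
    rw [integral_mul_const, mul_inv_cancel₀ hI₀pos.ne']
  have hφmass : ∫ x, Real.exp (φ x) * Real.exp (-V x) ∂vol = 1 := by
    simp_rw [hφV]
    exact hu1
  obtain ⟨o, ho⟩ := h2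
  have h2' : ∃ o : M, Integrable
      (fun x ↦ (g.riemEDist o x).toReal ^ 2 * (Real.exp (φ x) * Real.exp (-V x))) vol :=
    ⟨o, by simp_rw [hφV]; exact ho⟩
  -- the Fisher integrand of `φ`: `|∇φ|² = |∇(f − ψ)|² ≤ 2|∇f|² + 2|∇ψ|²`, `|∇f|² u ≤ f u ∈ L¹`
  have hgradφ : ∀ x, g.gradSq φ x = g.gradSq (fun y ↦ f y - ψ y) x := fun x ↦
    CarrilloNi2009_shrinkerLSI.gradSq_add_const c ((hf.sub hψ).mdifferentiableAt (by norm_num))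
  obtain ⟨hfu, hSu⟩ := CarrilloNi2009_shrinkerLSI.integrable_potential_mul_of_secondMoment hg hf
    hnorm (B := 0) (fun x ↦ by rw [neg_zero]; exact hS0 x) hucont (fun x ↦ (hupos x).le) huI ho
  have hgradfu : Integrable (fun x ↦ g.gradSq f x * u x) vol := by
    refine (hfu.sub hSu).congr (Eventually.of_forall fun x ↦ ?_)
    show f x * u x - g.scalarCurvature x * u x = g.gradSq f x * u x
    rw [← sub_mul]
    congr 1
    linarith [hnorm x]
  have hgradcont : ∀ {F : M → ℝ}, ContMDiff (𝓡 n) 𝓘(ℝ, ℝ) ∞ F → Continuous (g.gradSq F) :=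
    fun hF ↦ continuous_innerDual_mvfderiv g (hF.of_le (by norm_num)) (hF.of_le (by norm_num))
  have hmaj : Integrable (fun x ↦ 2 * (g.gradSq f x * u x + g.gradSq ψ x * u x)) vol :=
    (hgradfu.add hgradu).const_mul 2
  have hFisher' : Integrable (fun x ↦ g.gradSq (fun y ↦ f y - ψ y) x * u x) vol := by
    refine hmaj.mono' (((hgradcont (hf.sub hψ)).mul hucont).aestronglyMeasurable)
      (Eventually.of_forall fun x ↦ ?_)
    have hcs := CarrilloNi2009_shrinkerLSI.abs_innerDual_mvfderiv_le hg f ψ x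
    have hsub := CarrilloNi2009_shrinkerLSI.gradSq_sub (g := g)
      (hf.mdifferentiableAt (by norm_num) (x := x)) (hψ.mdifferentiableAt (by norm_num))
    have hnn : 0 ≤ g.gradSq (fun y ↦ f y - ψ y) x := g.gradSq_nonneg hg _ x
    rw [Real.norm_eq_abs, abs_mul, abs_of_nonneg (hupos x).le, abs_of_nonneg hnn, hsub]
    have h1 := (abs_le.1 hcs).1
    nlinarith [mul_nonneg (show 0 ≤ g.gradSq f x + g.gradSq ψ x + 2 * g.innerDual x
      (mvfderiv (𝓡 n) f x).toLinearMap (mvfderiv (𝓡 n) ψ x).toLinearMap by linarith) (hupos x).le]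
  have hFisher : Integrable (fun x ↦ g.gradSq φ x * (Real.exp (φ x) * Real.exp (-V x))) vol := by
    simp_rw [hφV, hgradφ]
    exact hFisher'
  /- the general inequality with `K = ½`, rewritten -/
  have hmain := hBE n M g V (1 / 2) hg hcpl hVs (by norm_num) hRic hmass φ hφs hφmass h2' hFisher
  have hl : ∫ x, φ x * (Real.exp (φ x) * Real.exp (-V x)) ∂vol = ∫ x, (f x + c - ψ x) * u x ∂vol := by
    refine integral_congr_ae (ae_of_all _ fun x ↦ ?_)
    beta_reduce
    rw [hφV]
    simp only [hφ]
    ring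
  have hr : ∫ x, g.gradSq φ x * (Real.exp (φ x) * Real.exp (-V x)) ∂vol =
      ∫ x, g.gradSq (fun y ↦ f y - ψ y) x * u x ∂vol := by
    refine integral_congr_ae (ae_of_all _ fun x ↦ ?_)
    beta_reduce
    rw [hφV, hgradφ]
  rw [hl, hr] at hmain
  norm_num at hmain
  exact hmain

end Shrinker

/-- **Registered helper `helper_bakryEmeryLSI_of_logSobolev`** (line `collapsed-ends-usc`, skeleton v9):
the registered fact stub `stub_bakryEmeryLSI` (BE) follows from the textbook Bakry–Émery logarithmic
Sobolev inequality of complete `CD(K, ∞)` weighted manifolds (written out; = the Literature fact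
`bakryEmery_logSobolev_complete` of p116121). [cite: CarrilloNi2009, Thm. 3.1 (p. 7)] -/
theorem helper_bakryEmeryLSI_of_logSobolev : (∀ (n : ℕ) (M : Type) [TopologicalSpace M] [T2Space M] [SecondCountableTopology M] [ChartedSpace (EuclideanSpace ℝ (Fin n)) M] [IsManifold (𝓡 n) ∞ M] [ConnectedSpace M] [T3Space M] [MeasurableSpace M] [BorelSpace M] (g : PseudoRiemannianMetric (𝓡 n) ∞ (EuclideanSpace ℝ (Fin n)) (TangentSpace (𝓡 n) : M → Type _)) [g.HasLeviCivita] (V : M → ℝ) (K : ℝ), g.IsRiemannian → (∀ (x : M) (r : NNReal), IsCompact {y : M | g.riemEDist x y ≤ r}) → ContMDiff (𝓡 n) 𝓘(ℝ, ℝ) ∞ V → 0 < K → (∀ (x : M) (X : TangentSpace (𝓡 n) x), K * g.val x X X ≤ g.ricci x X X + g.hessian V x X X) → ∫ x, Real.exp (-V x) ∂g.riemVolume = 1 → ∀ φ : M → ℝ, ContMDiff (𝓡 n) 𝓘(ℝ, ℝ) ∞ φ → ∫ x, Real.exp (φ x) * Real.exp (-V x) ∂g.riemVolume = 1 → (∃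 o : M, Integrable (fun x ↦ (g.riemEDist o x).toReal ^ 2 * (Real.exp (φ x) * Real.exp (-V x))) g.riemVolume) → Integrable (fun x ↦ g.gradSq φ x * (Real.exp (φ x) * Real.exp (-V x))) g.riemVolume → ∫ x, φ x * (Real.exp (φ x) * Real.exp (-V x)) ∂g.riemVolume ≤ 1 / (2 * K) * ∫ x, g.gradSq φ x * (Real.exp (φ x) * Real.exp (-V x)) ∂g.riemVolume) → ∀ (n : ℕ) (M : Type) [TopologicalSpace M] [T2Space M] [SecondCountableTopology M] [ChartedSpace (EuclideanSpace ℝ (Fin n)) M] [IsManifold (𝓡 n) ∞ M] [ConnectedSpace M] [T3Space M] [MeasurableSpace M] [BorelSpace M] (g : PseudoRiemannianMetric (𝓡 n) ∞ (EuclideanSpace ℝ (Fin n)) (TangentSpace (𝓡 n) : M → Type _)) [g.HasLeviCivita] (f : M → ℝ) (hg : g.IsRiemannian), (∀ (x : M) (r : NNReal), IsCompact {y : M | g.edist hg x y ≤ r}) → ContMDiff (𝓡 n) 𝓘(ℝ, ℝ) ∞ f → (∀ (x : M) (X Y : TangentSpace (𝓡 n) x), g.ricci x X Y + g.hessian f x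 X Y = (1 / 2 : ℝ) * g.val x X Y) → (∀ x : M, g.scalarCurvature x + g.gradSq f x = f x) → ∀ ψ : M → ℝ, ContMDiff (𝓡 n) 𝓘(ℝ, ℝ) ∞ ψ → g.IsEntropyCompatible ψ 1 → (∃ o : M, Integrable (fun x ↦ (g.riemEDist o x).toReal ^ 2 * entropyDensity n ψ 1 x) g.riemVolume) → Integrable (fun x ↦ g.gradSq ψ x * entropyDensity n ψ 1 x) g.riemVolume → ∫ x, (f x + Real.log ((4 * Real.pi) ^ (-(n : ℝ) / 2) * ∫ y, Real.exp (-f y) ∂g.riemVolume) - ψ x) * entropyDensity n ψ 1 x ∂g.riemVolume ≤ ∫ x, g.gradSq (fun y ↦ f y - ψ y) x * entropyDensity n ψ 1 x ∂g.riemVolume :=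
  fun hBE _ _ _ _ _ _ _ _ _ _ _ g _ f hg hc hf hsol hnorm _ hψ hψc h2 hgradu ↦
    relEntropy_le_relFisher_of_logSobolev hBE g f hg hc hf hsol hnorm hψ hψc h2 hgradu

end Summit.SmoothPoincare4.SmoothPoincare4.Theorems.NoncompactShrinkerGapBakryEmeryLSI

end
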